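/-
# Solo-blind programme on Kontsevich–Zagier, s6 part T3f: the golden dilogarithms

The three functional equations of the dilogarithm established *inside KZ's rules* —
Euler's reflection (`SoloBlindDilogEuler`), Landen's identity (`SoloBlindLanden`) and the
duplication formula (`SoloBlindDilogDup`) — close up at the golden ratio `φ`: with the algebraic
cuts `1/φ = φ − 1` and `1/φ² = 2 − φ` (`(φ−1)² = 2−φ`, `(φ−1)/(1+(φ−1)) = 2−φ`) they form a
`3 × 3` linear system for the classes of

  `D(1/φ²)`, `D(1/φ)` (periods `Li₂(1/φ²)`, `Li₂(1/φ)`) and `D⁻(1/φ)` (period `−Li₂(−1/φ)`),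

whose solution is (`mkQ_dilogGoldTwo`, `mkQ_dilogGoldOne`, `mkQ_dilogNegGold`)

  `[D(1/φ²)] = x_π²/15 − ℓ(φ)²`,  `[D(1/φ)] = x_π²/10 − ℓ(φ)²`,  `[D⁻(1/φ)] = x_π²/15 − ℓ(φ)²/2`

in `Q = FormalRep/relations`.  So these genuinely two-dimensional cells lie in the homogeneous
sector `H₂(φ)` of `SoloBlindHomogeneous`, and **the Kontsevich–Zagier conjecture holds for them**
(`kz_dilogGold…`, Gelfond–Schneider via `kz_homSector`); the period shadows are Landen's
evaluations `Li₂(1/φ²) = π²/15 − log²φ`, `Li₂(1/φ) = π²/10 − log²φ`,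
`Li₂(−1/φ) = −π²/15 + ½log²φ` (`dilogGoldTwo_value`, …), obtained here from the moves.  A fourth
Landen move (at `w = φ`, whose Landen cut is `1/φ`) adds the fifth golden cell `D⁻(φ)`:
`[D⁻(φ)] = x_π²/10 + ℓ(φ)²`, `−Li₂(−φ) = π²/10 + log²φ` (`mkQ_dilogNegPhi`, `dilogNegPhi_value`).
-/
import Summits.KontsevichZagierPeriods.KontsevichZagierPeriods.Theorems.SoloBlindLanden
import Summits.KontsevichZagierPeriods.KontsevichZagierPeriods.Theorems.SoloBlindDilogDup
import Summits.KontsevichZagierPeriods.KontsevichZagierPeriods.Theorems.SoloBlindHomogeneous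

noncomputable section

open MeasureTheory Set
open Literature.NumberTheory.Transcendental
open Literature.NumberTheory.Transcendental.KZ
open Literature.NumberTheory.Transcendental.KZ.IntegralRep
open scoped goldenRatio

namespace Summit.KontsevichZagierPeriods.KontsevichZagierPeriods.Theorems

namespace SoloBlind

/-! ## Golden arithmetic -/

/-- `φ` is algebraic (a root of `X² − X − 1`). -/
theorem isAlgebraic_goldenRatio : IsAlgebraic ℚ φ := by
  refine ⟨Polynomial.X ^ 2 - Polynomial.X - 1, fun h => ?_, ?_⟩
  · have h0 := congrArg (Polynomial.eval 0) h
    simp at h0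
  · simp [Real.goldenRatio_sq]

/-- `φ(φ − 1) = 1`. -/
theorem goldenRatio_mul_sub_one : φ * (φ - 1) = 1 := by
  have := Real.goldenRatio_sq; rw [sq] at this; linarith [this]

/-- `(φ − 1)² = 2 − φ`. -/
theorem goldenRatio_sub_one_sq : (φ - 1) ^ 2 = 2 - φ := by
  linarith [Real.goldenRatio_sq, sq (φ - 1), sub_sq φ 1]

/-- `1/(φ − 1) = φ`. -/
theorem inv_goldenRatio_sub_one : (φ - 1)⁻¹ = φ :=
  (eq_inv_of_mul_eq_one_left goldenRatio_mul_sub_one).symm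

/-- `1/φ = φ − 1`. -/
theorem inv_goldenRatio_eq : φ⁻¹ = φ - 1 :=
  inv_eq_of_mul_eq_one_right goldenRatio_mul_sub_one

/-- `1/(2 − φ) = φ²`. -/
theorem inv_two_sub_goldenRatio : (2 - φ)⁻¹ = φ ^ 2 := by
  rw [← goldenRatio_sub_one_sq, ← inv_pow, inv_goldenRatio_sub_one]

/-- `(φ − 1)/(1 + (φ − 1)) = 2 − φ`. -/
theorem goldenRatio_moebius : (φ - 1) * (1 + (φ - 1))⁻¹ = 2 - φ := by
  rw [add_sub_cancel, inv_goldenRatio_eq, ← sq, goldenRatio_sub_one_sq]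

/-! ## The golden cuts -/

/-- The cut `1/φ = φ − 1`. -/
def goldCut₁ : Cut := ⟨φ - 1, isAlgebraic_goldenRatio.sub isAlgebraic_one,
  by linarith [Real.one_lt_goldenRatio], by linarith [Real.goldenRatio_lt_two]⟩

/-- The cut `1/φ² = 2 − φ = 1 − 1/φ`. -/
def goldCut₂ : Cut := goldCut₁.symm

/-- `goldCut₁.x = φ − 1`. -/
theorem goldCut₁_x : goldCut₁.x = φ - 1 := rfl

/-- `goldCut₂.x = 2 − φ`. -/
theorem goldCut₂_x : goldCut₂.x = 2 - φ := by
  show 1 - (φ - 1) = 2 - φ; ring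

/-- Reflection swaps the golden cuts. -/
theorem goldCut₂_symm : goldCut₂.symm = goldCut₁ :=
  Cut.ext (by show 1 - (1 - (φ - 1)) = φ - 1; ring)

/-- Squaring maps `1/φ` to `1/φ²`. -/
theorem goldCut₁_sq : goldCut₁.sq = goldCut₂ := Cut.ext (by
  show (φ - 1) ^ 2 = 1 - (φ - 1)
  rw [goldenRatio_sub_one_sq]; ring)

/-- Landen's cut of `w = 1/φ` is `1/φ²`. -/
theorem ofPos_goldCut₁ : Cut.ofPos goldCut₁.alg goldCut₁.pos = goldCut₂ := Cut.ext (by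
  show (φ - 1) * (1 + (φ - 1))⁻¹ = 1 - (φ - 1)
  rw [goldenRatio_moebius]; ring)

/-- **The golden dilogarithm cells**: `D(1/φ²)` (period `Li₂(1/φ²)`), -/
abbrev dilogGoldTwo : IntegralRep 2 := dilogCut goldCut₂

/-- `D(1/φ)` (period `Li₂(1/φ)`), -/
abbrev dilogGoldOne : IntegralRep 2 := dilogCut goldCut₁

/-- `D⁻(1/φ)` (period `−Li₂(−1/φ)`). -/
abbrev dilogNegGold : IntegralRep 2 := dilogNeg goldCut₁.alg goldCut₁.pos

/-- The fifth golden cell `D⁻(φ)` (period `−Li₂(−φ)`). -/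
abbrev dilogNegPhi : IntegralRep 2 := dilogNeg isAlgebraic_goldenRatio Real.goldenRatio_pos

/-- The Landen cut of `φ` is `1/φ`: `φ/(1+φ) = φ − 1`. -/
theorem ofPos_goldenRatio : Cut.ofPos isAlgebraic_goldenRatio Real.goldenRatio_pos = goldCut₁ :=
  Cut.ext (by
    rw [Cut.ofPos_x, goldCut₁_x, add_comm, ← Real.goldenRatio_sq, sq, mul_inv,
      ← mul_assoc, mul_inv_cancel₀ Real.goldenRatio_pos.ne', one_mul, inv_goldenRatio_eq])

/-- `ℓ(φ²) = 2·ℓ(φ)`. -/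
theorem ell_goldenRatio_sq : ell (φ ^ 2) = 2 • ell φ := by
  have h1 := Real.one_lt_goldenRatio
  have h := ell_eq_sum_smul (isAlgebraic_goldenRatio.pow 2) (by nlinarith) (fun _ : Fin 1 => φ)
    (fun _ => isAlgebraic_goldenRatio) (fun _ => h1) (fun _ => 2)
    (by rw [Fin.sum_univ_one, Rat.cast_ofNat, Real.log_pow, Nat.cast_ofNat])
  rw [h, Fin.sum_univ_one, Rat.cast_ofNat, ofNat_smul_eq_nsmul]

/-! ## The three functional equations at the golden cuts -/

/-- Euler at `1/φ²`: `[Λ₂] = [D(1/φ²)] + [D(1/φ)] + 2ℓ(φ)·ℓ(φ)`. -/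
theorem gold_euler : mkQ (of simplexTwo) =
    mkQ (of dilogGoldTwo) + mkQ (of dilogGoldOne) + 2 • ell φ * ell φ := by
  have h := mkQ_simplexTwo_cut goldCut₂
  have e : (1 - (2 - φ))⁻¹ = φ := by
    rw [show 1 - (2 - φ) = φ - 1 by ring, inv_goldenRatio_sub_one]
  rw [goldCut₂_symm, goldCut₂_x, inv_two_sub_goldenRatio, ell_goldenRatio_sq, e] at h
  exact h

/-- Landen at `w = 1/φ`: `2·[D⁻(1/φ)] = 2·[D(1/φ²)] + ℓ(φ)²`. -/
theorem gold_landen : 2 • mkQ (of dilogNegGold) = 2 • mkQ (of dilogGoldTwo) + ell φ ^ 2 := by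
  have h := two_nsmul_mkQ_dilogNeg goldCut₁.alg goldCut₁.pos
  have e : ell (1 + goldCut₁.x) = ell φ := by rw [goldCut₁_x, add_sub_cancel]
  rwa [ofPos_goldCut₁, e] at h

/-- Landen at `w = φ`: `2·[D⁻(φ)] = 2·[D(1/φ)] + 4·ℓ(φ)²`. -/
theorem gold_landen_phi :
    2 • mkQ (of dilogNegPhi) = 2 • mkQ (of dilogGoldOne) + 4 • ell φ ^ 2 := by
  have h := two_nsmul_mkQ_dilogNeg isAlgebraic_goldenRatio Real.goldenRatio_pos
  have e : ell (1 + φ) = 2 • ell φ := by rw [add_comm, ← Real.goldenRatio_sq, ell_goldenRatio_sq]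
  rw [ofPos_goldenRatio, e] at h
  simp only [nsmul_eq_mul, Nat.cast_ofNat] at h ⊢
  linear_combination h

/-- Duplication at `1/φ`: `2·[D(1/φ)] = 2·[D⁻(1/φ)] + [D(1/φ²)]`. -/
theorem gold_dup :
    2 • mkQ (of dilogGoldOne) = 2 • mkQ (of dilogNegGold) + mkQ (of dilogGoldTwo) := by
  have h := two_nsmul_mkQ_dilogCut goldCut₁
  rwa [goldCut₁_sq] at h

/-- `6·[Λ₂] = x_π²`. -/
theorem six_mul_mkQ_simplexTwo : 6 * mkQ (of simplexTwo) = xPi ^ 2 := by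
  rw [mkQ_eq_mkQ_iff.2 simplexTwo_equiv_zetaTwoRep, ← six_smul_mkQ_zetaTwoRep,
    ofNat_smul_eq_nsmul, nsmul_eq_mul, Nat.cast_ofNat]

/-! ## Solving the system -/

/-- `15·([D(1/φ²)] + ℓ(φ)²) = x_π²`. -/
theorem fifteen_mul_dilogGoldTwo : 15 * (mkQ (of dilogGoldTwo) + ell φ ^ 2) = xPi ^ 2 := by
  have hE := gold_euler
  have hL := gold_landen
  have hD := gold_dup
  have hZ := six_mul_mkQ_simplexTwo
  simp only [nsmul_eq_mul, Nat.cast_ofNat] at hE hL hD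
  linear_combination (-6) * hE + (-3) * hL + (-3) * hD + hZ

/-- `10·([D(1/φ)] + ℓ(φ)²) = x_π²`. -/
theorem ten_mul_dilogGoldOne : 10 * (mkQ (of dilogGoldOne) + ell φ ^ 2) = xPi ^ 2 := by
  have hE := gold_euler
  have hL := gold_landen
  have hD := gold_dup
  have hZ := six_mul_mkQ_simplexTwo
  simp only [nsmul_eq_mul, Nat.cast_ofNat] at hE hL hD
  linear_combination (-6) * hE + 2 * hL + 2 * hD + hZ

/-- `30·[D⁻(1/φ)] + 15·ℓ(φ)² = 2x_π²`. -/
theorem thirty_mul_dilogNegGold : 30 * mkQ (of dilogNegGold) + 15 * ell φ ^ 2 = 2 * xPi ^ 2 := by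
  have hL := gold_landen
  have h2 := fifteen_mul_dilogGoldTwo
  simp only [nsmul_eq_mul, Nat.cast_ofNat] at hL
  linear_combination 15 * hL + 2 * h2

/-- A natural-number multiple in `Q` is the `K₀`-multiple. -/
theorem natCast_mul_eq_smul (n : ℕ) (y : Q) : (n : Q) * y = (n : K₀) • y := by
  rw [← nsmul_eq_mul, Nat.cast_smul_eq_nsmul]

/-- **`[D(1/φ²)] = x_π²/15 − ℓ(φ)²`** in `Q`. -/
theorem mkQ_dilogGoldTwo : mkQ (of dilogGoldTwo) = (15 : K₀)⁻¹ • xPi ^ 2 - ell φ ^ 2 := by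
  rw [eq_sub_iff_add_eq, eq_inv_smul_iff₀ (by norm_num : (15 : K₀) ≠ 0),
    ← fifteen_mul_dilogGoldTwo]
  exact (natCast_mul_eq_smul 15 _).symm

/-- **`[D(1/φ)] = x_π²/10 − ℓ(φ)²`** in `Q`. -/
theorem mkQ_dilogGoldOne : mkQ (of dilogGoldOne) = (10 : K₀)⁻¹ • xPi ^ 2 - ell φ ^ 2 := by
  rw [eq_sub_iff_add_eq, eq_inv_smul_iff₀ (by norm_num : (10 : K₀) ≠ 0),
    ← ten_mul_dilogGoldOne]
  exact (natCast_mul_eq_smul 10 _).symm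

/-- **`[D⁻(1/φ)] = (2x_π² − 15ℓ(φ)²)/30`** in `Q`. -/
theorem mkQ_dilogNegGold :
    mkQ (of dilogNegGold) = (30 : K₀)⁻¹ • (2 • xPi ^ 2 - 15 • ell φ ^ 2) := by
  rw [eq_inv_smul_iff₀ (by norm_num : (30 : K₀) ≠ 0), eq_sub_iff_add_eq, nsmul_eq_mul,
    nsmul_eq_mul, Nat.cast_ofNat, Nat.cast_ofNat, ← thirty_mul_dilogNegGold]
  exact congrArg (· + _) (natCast_mul_eq_smul 30 _).symm

/-- `5·([D⁻(φ)] − ℓ(φ)²) = x_π²/2 · …`: precisely `10·[D⁻(φ)] = x_π² + 10·ℓ(φ)²`. -/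
theorem ten_mul_dilogNegPhi : 10 * mkQ (of dilogNegPhi) = xPi ^ 2 + 10 * ell φ ^ 2 := by
  have hL := gold_landen_phi
  have h1 := ten_mul_dilogGoldOne
  simp only [nsmul_eq_mul, Nat.cast_ofNat] at hL
  linear_combination 5 * hL + h1

/-- **`[D⁻(φ)] = x_π²/10 + ℓ(φ)²`** in `Q`. -/
theorem mkQ_dilogNegPhi : mkQ (of dilogNegPhi) = (10 : K₀)⁻¹ • xPi ^ 2 + ell φ ^ 2 := by
  rw [← sub_eq_iff_eq_add, eq_inv_smul_iff₀ (by norm_num : (10 : K₀) ≠ 0)]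
  have e : (10 : K₀) • (mkQ (of dilogNegPhi) - ell φ ^ 2) =
      10 * (mkQ (of dilogNegPhi) - ell φ ^ 2) := (natCast_mul_eq_smul 10 _).symm
  rw [e]
  linear_combination ten_mul_dilogNegPhi

/-! ## Membership in `H₂(φ)` and the conjecture -/

/-- `x_π² ∈ H₂(φ)` and `ℓ(φ)² ∈ H₂(φ)` span what we need. -/
theorem xPi_sq_mem_span : xPi ^ 2 ∈ Submodule.span K₀ (Set.range (homGen φ 2)) :=
  Submodule.subset_span ⟨Fin.last 2, by simp [homGen]⟩

/-- `ℓ(φ)²` is a generator of `H₂(φ)`. -/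
theorem ell_sq_mem_span : ell φ ^ 2 ∈ Submodule.span K₀ (Set.range (homGen φ 2)) :=
  Submodule.subset_span ⟨0, by simp [homGen]⟩

/-- `D(1/φ²) ∈ H₂(φ)`. -/
theorem dilogGoldTwo_mem : of dilogGoldTwo ∈ homSector φ 2 := by
  rw [mem_modSector, mkQ_dilogGoldTwo]
  exact sub_mem (Submodule.smul_mem _ _ xPi_sq_mem_span) ell_sq_mem_span

/-- `D(1/φ) ∈ H₂(φ)`. -/
theorem dilogGoldOne_mem : of dilogGoldOne ∈ homSector φ 2 := by
  rw [mem_modSector, mkQ_dilogGoldOne]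
  exact sub_mem (Submodule.smul_mem _ _ xPi_sq_mem_span) ell_sq_mem_span

/-- `D⁻(1/φ) ∈ H₂(φ)`. -/
theorem dilogNegGold_mem : of dilogNegGold ∈ homSector φ 2 := by
  rw [mem_modSector, mkQ_dilogNegGold]
  exact Submodule.smul_mem _ _ (sub_mem (Submodule.smul_of_tower_mem _ 2 xPi_sq_mem_span)
    (Submodule.smul_of_tower_mem _ 15 ell_sq_mem_span))

/-- `D⁻(φ) ∈ H₂(φ)`. -/
theorem dilogNegPhi_mem : of dilogNegPhi ∈ homSector φ 2 := by
  rw [mem_modSector, mkQ_dilogNegPhi]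
  exact add_mem (Submodule.smul_mem _ _ xPi_sq_mem_span) ell_sq_mem_span

/-- **The Kontsevich–Zagier conjecture holds for the golden dilogarithm cells**: each of
`D(1/φ²)`, `D(1/φ)`, `D⁻(1/φ)`, `D⁻(φ)` is connected by the three moves to every integral
representation in the sector `H₂(φ)` (e.g. `Z`, `S`, `Λ₂`, `L(1;φ)²`, the other three) with the
same period. -/
theorem kz_dilogGold {m : ℕ} {r : IntegralRep 2} (hr : of r ∈ homSector φ 2) (r' : IntegralRep m)
    (hr' : of r' ∈ homSector φ 2) (hv : r.value = r'.value) : Equivalent r r' :=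
  kz_homSector isAlgebraic_goldenRatio Real.one_lt_goldenRatio r r' hr hr' hv

/-- In particular for `D(1/φ²)`. -/
theorem kz_dilogGoldTwo {m : ℕ} (r' : IntegralRep m) (hr' : of r' ∈ homSector φ 2)
    (hv : dilogGoldTwo.value = r'.value) : Equivalent dilogGoldTwo r' :=
  kz_dilogGold dilogGoldTwo_mem r' hr' hv

/-! ## The period shadows -/

/-- `evalQ (ℓ(φ)²) = log²φ` and `evalQ x_π² = π²`. -/
theorem evalQ_gold_gens : evalQ (xPi ^ 2) = Real.pi ^ 2 ∧ evalQ (ell φ ^ 2) = Real.log φ ^ 2 := by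
  rw [map_pow, map_pow, evalQ_xPi, evalQ_ell isAlgebraic_goldenRatio Real.one_lt_goldenRatio.le]
  exact ⟨rfl, rfl⟩

/-- **`Li₂(1/φ²) = π²/15 − log²φ`**: `value D(1/φ²)`. -/
theorem dilogGoldTwo_value : dilogGoldTwo.value = Real.pi ^ 2 / 15 - Real.log φ ^ 2 := by
  have h := congrArg evalQ fifteen_mul_dilogGoldTwo
  rw [map_mul, map_add, evalQ_gold_gens.1, evalQ_gold_gens.2, evalQ_mkQ, eval_of, map_ofNat] at h
  linarith

/-- **`Li₂(1/φ) = π²/10 − log²φ`**: `value D(1/φ)`. -/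
theorem dilogGoldOne_value : dilogGoldOne.value = Real.pi ^ 2 / 10 - Real.log φ ^ 2 := by
  have h := congrArg evalQ ten_mul_dilogGoldOne
  rw [map_mul, map_add, evalQ_gold_gens.1, evalQ_gold_gens.2, evalQ_mkQ, eval_of, map_ofNat] at h
  linarith

/-- **`−Li₂(−1/φ) = π²/15 − ½log²φ`**: `value D⁻(1/φ)`. -/
theorem dilogNegGold_value : dilogNegGold.value = Real.pi ^ 2 / 15 - Real.log φ ^ 2 / 2 := by
  have h := congrArg evalQ thirty_mul_dilogNegGold
  rw [map_add, map_mul, map_mul, map_mul, evalQ_gold_gens.1, evalQ_gold_gens.2, evalQ_mkQ, eval_of,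
    map_ofNat, map_ofNat, map_ofNat] at h
  linarith

/-- **`−Li₂(−φ) = π²/10 + log²φ`.** -/
theorem dilogNegPhi_value : dilogNegPhi.value = Real.pi ^ 2 / 10 + Real.log φ ^ 2 := by
  have h := congrArg evalQ ten_mul_dilogNegPhi
  rw [map_add, map_mul, map_mul, evalQ_gold_gens.1, evalQ_gold_gens.2, evalQ_mkQ, eval_of,
    map_ofNat] at h
  linarith

end SoloBlind

end Summit.KontsevichZagierPeriods.KontsevichZagierPeriods.Theorems
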